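import Literature.MathematicalPhysics.QuantumFieldTheory.Balaban1983to89.B6RandomWalkL2Blocks
import Literature.MathematicalPhysics.QuantumFieldTheory.Balaban1983to89.B9Ineq377L2
import Literature.MathematicalPhysics.QuantumFieldTheory.Balaban1983to89.B9Ineq377POneConcrete
import Literature.MathematicalPhysics.QuantumFieldTheory.Balaban1983to89.B9Ineq385L2V3Right

/-!
# `Balaban1983to89.B9Ineq377L2Hom` — B9 p. 406 (3.77) IN BLOCK-`ℓ²` FOR LETTERS TYPED BETWEEN TWO CARRIERS, AND WITH THE DIFFERENTIAL
# LETTERS `D_{U′U} − D_U`, `D*_{U′U} − D*_U` OF (3.70)/(3.74)/(3.76) CONCRETE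

The block-`ℓ²` ((2.140) of [4]) twin of `B9Ineq377POneConcrete` §1–§2, word for word through the `ℓ²` block embedding `B6RandomWalkL2Blocks`:

* §0 ★ `hasL2MajorantHom_of_hasMajorantHom_local` — SUP two-carrier majorant (`B6RandomWalkHom.HasMajorantHom`) + entry locality + column
  multiplicity `N` ⟹ block-`ℓ²` two-carrier majorant `√N·K` (`B6RandomWalkL2Hom.HasL2MajorantHom`); proof = the one-carrier bridge
  `B9Ineq385L2V3Right.hasL2Majorant_of_hasMajorant_local` on `X ⊕ Y` for `(0 0; T 0)`.
* §1 ★ `hasL2MajorantHom_conjHom_of_local` — the seam for stencil-local `E`-valued letters after real coordinates (`B9Eq376POneLetters.conjHom`):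
  multiplicity `N·#ι`; ★ `hasL2MajorantHom_gradLin_sub`, ★ `hasL2MajorantHom_divLin_sub` — the first-order letters `E = D_{U′U} − D_U` (sites → bonds)
  and `E* = D*_{U′U} − D*_U` (bonds → sites) in block-`ℓ²`: FILE 10's sup sizes (`B9Eq376POneLetters.hasMajorantHom_gradLin_sub/_divLin_sub`) times
  `√((#κ+1)·#ι)` (one-point stencils: the `f(x)` / `F_ν(x)` terms cancel in the differences (3.70)/(3.74)).
* §2 ★★ `ineq377_l2_hom` — (3.77) in block-`ℓ²` for letters `D, D′ : X → Y`, `D*, D*′ : Y → X`, `P, P′` on `X`: `B9Ineq377L2.ineq377_l2` on `X ⊕ Y`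
  through `emb₄`, read off the bond block (`pOne_emb₄`, `hasL2Majorant_of_emb₄_inr_inr`) — the SAME constant `κ₃₇₇` as the sup shape.
* §3 ★★ `ineq377_l2_concreteE` — §2 with the differential letters concrete (`conjHom b (gradLin …)`, `conjHom b (divLin …)` at `U` and at
  `U′U = prodCfg U η A`) and §1's `E`-sizes: `P₁(A) ≺₂ κ₃₇₇(c_E, κ_P, κ_{P′}, Λ, c₁(β), α₁)·α₁·(Lʲη)⁻²·e^{−ρd}` on the bond carrier with
  `c_E = √((#κ+1)·#ι)·4(1+#κ)·M₂Σ_i‖b_i‖·e^{δd₀}`; the (3.49)/(3.68) entries of `P = P(U)`, `P′ = P′(A)` stay typed block-`ℓ²` hypotheses (their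
  discharge from `ℓ²` READINGS of `Q′, Q′*, C⁻¹, G` is `B9Ineq377L2.ineq349_l2` / `ineq368_l2` on the site carrier — successor assembly).

HONEST SCOPE.  Finite-dimensional bookkeeping on finite carriers; every letter not made concrete is a binder with its size as hypothesis; nothing
of [B9] is asserted for Bałaban's operators; count-neutral; NOT a node discharge; nothing continuum ∕ OS ∕ mass-gap ∕ Clay.  Cell `pub-ymgap`
(HUMAN RULING D-0062), Track A node N06 [B9], N06-ASSIGNMENT row 13 (G-side `ℓ²` route to the six `SectBFrame₄.stepL2G`), seat
`pub-ymgap-dag-n06-c` (g5), 2026-08-27.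
-/

noncomputable section

open scoped BigOperators

namespace Literature.MathematicalPhysics.QuantumFieldTheory.Balaban1983to89.B9Ineq377L2Hom

open Literature.MathematicalPhysics.QuantumFieldTheory.Balaban1983to89
open Literature.MathematicalPhysics.QuantumFieldTheory.Balaban1983to89.B6RandomWalk (Triangle254 Ineq261)
open Literature.MathematicalPhysics.QuantumFieldTheory.Balaban1983to89.B6RandomWalkL2 (HasL2Majorant hasL2Majorant_mono hasL2Majorant_add)
open Literature.MathematicalPhysics.QuantumFieldTheory.Balaban1983to89.B6RandomWalkL2Hom (HasL2MajorantHom)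
open Literature.MathematicalPhysics.QuantumFieldTheory.Balaban1983to89.B6RandomWalkBlocks (emb₄ emb₄_add emb₄_apply_inl emb₄_apply_inr)
open Literature.MathematicalPhysics.QuantumFieldTheory.Balaban1983to89.B6RandomWalkL2Blocks
open Literature.MathematicalPhysics.QuantumFieldTheory.Balaban1983to89.B9Thm34Ext (toB6)
open Literature.MathematicalPhysics.QuantumFieldTheory.Balaban1983to89.B9Ineq347 (ScaleTransfer)
open Literature.MathematicalPhysics.QuantumFieldTheory.Balaban1983to89.B9Ineq377POne (kappa377 kappa377_nonneg)
open Literature.MathematicalPhysics.QuantumFieldTheory.Balaban1983to89.B9Ineq377L2 (ineq377_l2)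
open Literature.MathematicalPhysics.QuantumFieldTheory.Balaban1983to89.B9Ineq377POneConcrete (emb₄_C_mul_A emb₄_A_mul_B emb₄_C_mul_A_mul_B pOne_emb₄)
open Literature.MathematicalPhysics.QuantumFieldTheory.Balaban1983to89.B9Eq386Neumann (pOne)
open Literature.MathematicalPhysics.QuantumFieldTheory.Balaban1983to89.B6RandomWalk (HasMajorant)
open Literature.MathematicalPhysics.QuantumFieldTheory.Balaban1983to89.B6RandomWalkHom (HasMajorantHom hasMajorantHom_mono)
open Literature.MathematicalPhysics.QuantumFieldTheory.Balaban1983to89.B9Ineq385L2V3Right (hasL2Majorant_of_hasMajorant_local)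
open Literature.MathematicalPhysics.QuantumFieldTheory.Balaban1983to89.B9Ineq346L2RightDiff (coordSymm_single)
open Literature.MathematicalPhysics.QuantumFieldTheory.Balaban1983to89.B9Eq352DivForm (tauB)
open Literature.MathematicalPhysics.QuantumFieldTheory.Balaban1983to89.B9Eq352DivFormLetters (coordEquiv)
open Literature.MathematicalPhysics.QuantumFieldTheory.Balaban1983to89.B9Eq39Adjoint (prodCfg)
open Literature.MathematicalPhysics.QuantumFieldTheory.Balaban1983to89.B9Eq376POneLetters

/-! ## §0  Sup two-carrier majorant + locality + multiplicity ⟹ block-`ℓ²` two-carrier majorant -/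

section Bridge

variable {G₆ : B6.Geometry} [DecidableEq G₆.Site] {X Y : Type} [Fintype X] [DecidableEq X] [Fintype Y] [DecidableEq Y]

omit [Fintype X] [Fintype Y] in
/-- the point mass at `inl x′` restricted to `X` is the point mass at `x′`. [folklore] -/
private theorem single_inl_comp_inl (x' : X) : ((Pi.single (Sum.inl x') (1 : ℝ) : X ⊕ Y → ℝ) ∘ Sum.inl) = Pi.single x' 1 := by
  funext x
  simp [Pi.single_apply]

omit [Fintype X] [Fintype Y] in
/-- the point mass at `inl x′` restricted to `Y` vanishes. [folklore] -/
private theorem single_inl_comp_inr (x' : X) : ((Pi.single (Sum.inl x') (1 : ℝ) : X ⊕ Y → ℝ) ∘ Sum.inr) = (0 : Y → ℝ) := by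
  funext v
  simp

omit [Fintype X] [Fintype Y] in
/-- the point mass at `inr y′` restricted to `X` vanishes. [folklore] -/
private theorem single_inr_comp_inl (y' : Y) : ((Pi.single (Sum.inr y') (1 : ℝ) : X ⊕ Y → ℝ) ∘ Sum.inl) = (0 : X → ℝ) := by
  funext x
  simp

/-- **SUP TWO-CARRIER MAJORANT + LOCALITY + MULTIPLICITY ⟹ BLOCK-`ℓ²` TWO-CARRIER MAJORANT.**  If `T : (X → ℝ) → (Y → ℝ)` has the sup-shape majorant
`K ≧ 0` (`B6RandomWalkHom.HasMajorantHom`), its entry `(y, x′)` vanishes unless `near y x′`, and every column `x′` has at most `N` rows `y` near it, then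
`T ≺₂ √N·K` (`B6RandomWalkL2Hom.HasL2MajorantHom`).  Proof: the one-carrier bridge `B9Ineq385L2V3Right.hasL2Majorant_of_hasMajorant_local` for the block
operator `(0 0; T 0)` on `X ⊕ Y` (`B6RandomWalkBlocks.hasMajorant_emb₄_inr_inl`), read back by `B6RandomWalkL2Blocks.hasL2MajorantHom_of_emb₄_inr_inl`.
[cite: Balaban1984PropagatorsII, (2.51) p.232 + (2.140)–(2.141) p.247; Balaban1985BackgroundPropagators, (3.37) p.396] -/
theorem hasL2MajorantHom_of_hasMajorantHom_local (blkX : X → G₆.Site) (blkY : Y → G₆.Site) {T : (X → ℝ) →ₗ[ℝ] (Y → ℝ)}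
    {K : G₆.Site → G₆.Site → ℝ} (near : Y → X → Prop) (N : ℕ) (hT : HasMajorantHom blkX blkY T K) (hK : ∀ a a', 0 ≤ K a a')
    (hloc : ∀ y x', T (Pi.single x' 1) y ≠ 0 → near y x')
    (hmult : ∀ x', ∃ s : Finset Y, (s.card : ℝ) ≤ N ∧ ∀ y, near y x' → y ∈ s) :
    HasL2MajorantHom blkX blkY T (fun a a' => Real.sqrt N * K a a') := by
  classical
  have hW := B6RandomWalkBlocks.hasMajorant_emb₄_inr_inl (blkX := blkX) (blkY := blkY) hT hK
  have h2 := hasL2Majorant_of_hasMajorant_local (G₆ := G₆) (Sum.elim blkX blkY)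
    (fun z z' : X ⊕ Y => ∃ (y : Y) (x' : X), z = Sum.inr y ∧ z' = Sum.inl x' ∧ near y x') N hW hK ?_ ?_
  · exact hasL2MajorantHom_of_emb₄_inr_inl h2
  · rintro z z' h
    rcases z' with x' | y'
    · rcases z with x | y
      · exfalso
        apply h
        simp only [emb₄_apply_inl, LinearMap.zero_apply, Pi.zero_apply, add_zero]
      · refine ⟨y, x', rfl, rfl, hloc y x' ?_⟩
        simp only [emb₄_apply_inr, single_inl_comp_inl, LinearMap.zero_apply, Pi.zero_apply, add_zero] at h
        exact h
    · exfalso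
      apply h
      rcases z with x | y
      · simp only [emb₄_apply_inl, LinearMap.zero_apply, Pi.zero_apply, add_zero]
      · simp only [emb₄_apply_inr, single_inr_comp_inl, map_zero, LinearMap.zero_apply, Pi.zero_apply, add_zero]
  · intro z'
    rcases z' with x' | y'
    · obtain ⟨s, hs, hmem⟩ := hmult x'
      refine ⟨s.map ⟨Sum.inr, Sum.inr_injective⟩, by simpa using hs, ?_⟩
      rintro z ⟨y, x'', rfl, hx, hn⟩
      have hx' : x'' = x' := Sum.inl_injective hx.symm
      subst hx'
      simpa [Finset.mem_map] using hmem y hn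
    · refine ⟨∅, by simp, ?_⟩
      rintro z ⟨y, x'', rfl, hx, -⟩
      exact absurd hx Sum.inr_ne_inl

end Bridge

/-! ## §1  The seam in block-`ℓ²` for two-carrier letters after real coordinates; the first-order letters `E`, `E*` of (3.70)/(3.74) -/

section Seam

variable {E : Type*} [NormedAddCommGroup E] [NormedSpace ℝ E] {ι : Type} [Fintype ι] [DecidableEq ι] {X Y : Type}
variable [Fintype X] [DecidableEq X] [Fintype Y] [DecidableEq Y] (b : Module.Basis ι ℝ E)
variable {g : B9.Geometry} [Fintype g.Site] {Rr : ℝ} {H : Prop}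

/-- **THE SEAM IN BLOCK-`ℓ²`, TWO CARRIERS**: a stencil-local letter `L : (X → E) → (Y → E)` (`(Lf)(v)` depends only on `f` at the points `x′` with
`near v x′`; every `x′` is a stencil point of at most `N` points `v`) whose real-coordinate reading `conjHom b L` has a sup-shape two-carrier majorant
`K ≧ 0` has the block-`ℓ²` two-carrier majorant `√(N·#ι)·K` (§0 on the carriers `X × ι`, `Y × ι`: the entry `((v,i),(x′,i′))` of `conjHom b L` vanishes
unless `near v x′`, by `coordSymm_single`).  [cite: Balaban1984PropagatorsII, (2.51) p.232 + (2.140) p.247; Balaban1985BackgroundPropagators, (3.42) p.397 + (3.37) p.396] -/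
theorem hasL2MajorantHom_conjHom_of_local (blkX : X → g.Site) (blkY : Y → g.Site) (near : Y → X → Prop) (N : ℕ)
    (hmult : ∀ x', ∃ s : Finset Y, (s.card : ℝ) ≤ N ∧ ∀ v, near v x' → v ∈ s)
    (L : (X → E) →ₗ[ℝ] (Y → E)) (hloc : ∀ (f : X → E) (v : Y), (∀ x', near v x' → f x' = 0) → L f v = 0)
    {K : g.Site → g.Site → ℝ} (hK0 : ∀ a a', 0 ≤ K a a')
    (hK : HasMajorantHom (g := toB6 g Rr H) (fun p : X × ι => blkX p.1) (fun q : Y × ι => blkY q.1) (conjHom b L) K) :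
    HasL2MajorantHom (g := toB6 g Rr H) (fun p : X × ι => blkX p.1) (fun q : Y × ι => blkY q.1) (conjHom b L)
      (fun a a' => Real.sqrt ((N * Fintype.card ι : ℕ) : ℝ) * K a a') := by
  classical
  refine hasL2MajorantHom_of_hasMajorantHom_local (G₆ := toB6 g Rr H) (fun p : X × ι => blkX p.1) (fun q : Y × ι => blkY q.1)
    (fun q p => near q.1 p.1) _ hK hK0 ?_ ?_
  · rintro ⟨v, j⟩ ⟨x', i⟩ h
    by_contra hn
    apply h
    rw [conjHom_apply, coordSymm_single]
    have h0 : L (Pi.single x' (b i)) v = 0 := by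
      refine hloc _ v fun x'' hx'' => ?_
      have hne : x'' ≠ x' := by
        rintro rfl
        exact hn hx''
      exact Pi.single_eq_of_ne hne _
    rw [h0, map_zero, Finsupp.zero_apply]
  · rintro ⟨x', i⟩
    obtain ⟨s, hs, hmem⟩ := hmult x'
    refine ⟨s ×ˢ (Finset.univ : Finset ι), ?_, ?_⟩
    · rw [Finset.card_product, Finset.card_univ]
      push_cast
      exact mul_le_mul_of_nonneg_right hs (Nat.cast_nonneg _)
    · rintro ⟨v, j⟩ hv
      exact Finset.mem_product.mpr ⟨hmem v hv, Finset.mem_univ _⟩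

end Seam

section FirstOrder

variable {𝔸 : Type*} [NormedRing 𝔸] [NormedAlgebra ℂ 𝔸] [CompleteSpace 𝔸] {S : Type} {κ : Type} [Fintype S] [DecidableEq S]
variable [Fintype κ] [DecidableEq κ]
variable (T : κ → Equiv.Perm S) (U : κ → S → 𝔸ˣ)
variable {ι : Type} [Fintype ι] [DecidableEq ι] (b : Module.Basis ι ℝ 𝔸)
variable {g : B9.Geometry} [Fintype g.Site] {Rr : ℝ} {H : Prop}

/-- **`E = D_{U′U} − D_U` IN BLOCK-`ℓ²`** (sites → bonds): FILE 10's sup-shape size `B9Eq376POneLetters.hasMajorantHom_gradLin_sub` (`4M₂Σ‖b_i‖e^{δd₀}·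
α₁(Lʲη)⁻¹·e^{−δd}`) times the multiplicity factor `√((#κ+1)·#ι)`: the letter reads `f` at the ONE point `x + e_μ` of the bond `⟨x, x+e_μ⟩` ((3.70): the
`f(x)` terms cancel in the difference), and a site is the endpoint `x + e_μ` of `#κ ≦ #κ + 1` bonds.
[cite: Balaban1985BackgroundPropagators, (3.70) p.404 + (3.76) p.405 + (3.37) p.396; Balaban1984PropagatorsII, (2.51) p.232 + (2.140) p.247] -/
theorem hasL2MajorantHom_gradLin_sub (blk : S → g.Site) {η : ℝ} (hη : 0 < η)
    (hU1 : ∀ μ x, ‖((U μ x : 𝔸ˣ) : 𝔸)‖ ≤ 1 ∧ ‖(((U μ x)⁻¹ : 𝔸ˣ) : 𝔸)‖ ≤ 1) (A : κ → S → 𝔸) (d₀ δ M₂ α₁ : ℝ)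
    (hα₁ : 0 ≤ α₁) (hδ : 0 ≤ δ) (hM₂ : 0 ≤ M₂) (hrepr : ∀ (w : 𝔸) (i : ι), |b.repr w i| ≤ M₂ * ‖w‖)
    (hlen : ∀ y : g.Site, 0 < g.len y) (hA : ∀ k x, ‖A k x‖ ≤ α₁ * (g.len (blk x))⁻¹)
    (hsmall : ∀ y : g.Site, η * (α₁ * (g.len y)⁻¹) ≤ 1 / 4) (hd₀F : ∀ μ x, g.dist (blk x) (blk (T μ x)) ≤ d₀) :
    HasL2MajorantHom (g := toB6 g Rr H) (fun p : S × ι => blk p.1) (fun q : (κ × S) × ι => blk q.1.2)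
      (conjHom b (gradLin T ((η : ℂ)⁻¹) (prodCfg U η A) - gradLin T ((η : ℂ)⁻¹) U))
      (fun a a' => Real.sqrt (((Fintype.card κ + 1) * Fintype.card ι : ℕ) : ℝ)
        * (4 * (M₂ * ∑ i, ‖b i‖) * Real.exp (δ * d₀) * α₁ * (g.len a)⁻¹ * Real.exp (-(δ * g.dist a a')))) := by
  classical
  have hsup := hasMajorantHom_gradLin_sub (Rr := Rr) (H := H) T U b blk hη hU1 A d₀ δ M₂ α₁ hα₁ hδ hM₂ hrepr hlen hA hsmall hd₀F
  have hbs : 0 ≤ ∑ i, ‖b i‖ := Finset.sum_nonneg fun i _ => norm_nonneg _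
  have hK0 : ∀ a a' : g.Site, 0 ≤ 4 * (M₂ * ∑ i, ‖b i‖) * Real.exp (δ * d₀) * α₁ * (g.len a)⁻¹ * Real.exp (-(δ * g.dist a a')) :=
    fun a a' => by have := inv_nonneg.mpr (hlen a).le; positivity
  refine hasL2MajorantHom_conjHom_of_local (Rr := Rr) (H := H) b blk (fun q : κ × S => blk q.2)
    (fun q x' => x' = T q.1 q.2) (Fintype.card κ + 1) ?_ _ ?_ hK0 hsup
  · intro x'
    refine ⟨Finset.univ.image fun k : κ => (k, (T k).symm x'), ?_, ?_⟩
    · have hc := (Finset.card_image_le (s := (Finset.univ : Finset κ)) (f := fun k : κ => (k, (T k).symm x')))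
      rw [Finset.card_univ] at hc
      push_cast
      exact_mod_cast hc.trans (Nat.le_succ _)
    · rintro ⟨k, x⟩ hx
      refine Finset.mem_image.mpr ⟨k, Finset.mem_univ _, ?_⟩
      simp only at hx
      rw [hx, Equiv.symm_apply_apply]
  · intro f q hf
    have hsm : η * ‖A q.1 q.2‖ ≤ 1 / 2 :=
      (mul_le_mul_of_nonneg_left (hA q.1 q.2) hη.le).trans ((hsmall _).trans (by norm_num))
    have h := norm_gradLin_sub_apply_le T U hη.le hU1 A ((η : ℂ)⁻¹) f q hsm
    rw [hf _ rfl, norm_zero, mul_zero] at h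
    exact norm_le_zero_iff.mp h

/-- **`E* = D*_{U′U} − D*_U` IN BLOCK-`ℓ²`** (bonds → sites): FILE 10's `hasMajorantHom_divLin_sub` (`4#κ·M₂Σ‖b_i‖e^{δd₀}·α₁(Lʲη)⁻¹e^{−δd}`) times
`√((#κ+1)·#ι)`: the letter reads the bond function at the bonds `⟨x − e_ν, x⟩` ((3.74): the `F_ν(x)` terms cancel), and a bond `⟨z, z + e_ν⟩` is read by
the ONE site `z + e_ν` (`1 ≦ #κ + 1`). [cite: Balaban1985BackgroundPropagators, (3.74) p.405 + (3.76) p.405 + (3.37) p.396; Balaban1984PropagatorsII, (2.51) p.232 + (2.140) p.247] -/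
theorem hasL2MajorantHom_divLin_sub (blk : S → g.Site) {η : ℝ} (hη : 0 < η)
    (hU1 : ∀ μ x, ‖((U μ x : 𝔸ˣ) : 𝔸)‖ ≤ 1 ∧ ‖(((U μ x)⁻¹ : 𝔸ˣ) : 𝔸)‖ ≤ 1) (A : κ → S → 𝔸) (d₀ δ M₂ α₁ : ℝ)
    (hα₁ : 0 ≤ α₁) (hδ : 0 ≤ δ) (hM₂ : 0 ≤ M₂) (hrepr : ∀ (w : 𝔸) (i : ι), |b.repr w i| ≤ M₂ * ‖w‖)
    (hlen : ∀ y : g.Site, 0 < g.len y) (hAτB : ∀ ν x, ‖tauB T U ν (A ν) x‖ ≤ α₁ * (g.len (blk x))⁻¹)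
    (hsmall : ∀ y : g.Site, η * (α₁ * (g.len y)⁻¹) ≤ 1 / 4) (hd₀B : ∀ ν x, g.dist (blk x) (blk ((T ν).symm x)) ≤ d₀) :
    HasL2MajorantHom (g := toB6 g Rr H) (fun q : (κ × S) × ι => blk q.1.2) (fun p : S × ι => blk p.1)
      (conjHom b (divLin T ((η : ℂ)⁻¹) (prodCfg U η A) - divLin T ((η : ℂ)⁻¹) U))
      (fun a a' => Real.sqrt (((Fintype.card κ + 1) * Fintype.card ι : ℕ) : ℝ)
        * (4 * Fintype.card κ * (M₂ * ∑ i, ‖b i‖) * Real.exp (δ * d₀) * α₁ * (g.len a)⁻¹ * Real.exp (-(δ * g.dist a a')))) := by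
  classical
  have hsup := hasMajorantHom_divLin_sub (Rr := Rr) (H := H) T U b blk hη hU1 A d₀ δ M₂ α₁ hα₁ hδ hM₂ hrepr hlen hAτB hsmall hd₀B
  have hbs : 0 ≤ ∑ i, ‖b i‖ := Finset.sum_nonneg fun i _ => norm_nonneg _
  have hcard : (0 : ℝ) ≤ Fintype.card κ := Nat.cast_nonneg _
  have hK0 : ∀ a a' : g.Site,
      0 ≤ 4 * Fintype.card κ * (M₂ * ∑ i, ‖b i‖) * Real.exp (δ * d₀) * α₁ * (g.len a)⁻¹ * Real.exp (-(δ * g.dist a a')) :=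
    fun a a' => by have := inv_nonneg.mpr (hlen a).le; positivity
  refine hasL2MajorantHom_conjHom_of_local (Rr := Rr) (H := H) b (fun q : κ × S => blk q.2) blk
    (fun x q => q.2 = (T q.1).symm x) (Fintype.card κ + 1) ?_ _ ?_ hK0 hsup
  · rintro ⟨ν, z⟩
    refine ⟨{T ν z}, ?_, ?_⟩
    · rw [Finset.card_singleton]; push_cast; linarith
    · intro x hx
      simp only at hx
      rw [Finset.mem_singleton, hx, Equiv.apply_symm_apply]
  · intro F x hF
    have hsm : ∀ ν, η * ‖tauB T U ν (A ν) x‖ ≤ 1 / 2 := fun ν =>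
      (mul_le_mul_of_nonneg_left (hAτB ν x) hη.le).trans ((hsmall _).trans (by norm_num))
    have h := norm_divLin_sub_apply_le T U hη.le hU1 A ((η : ℂ)⁻¹) F x hsm
    have h0 : ∑ ν, (4 * (η * ‖tauB T U ν (A ν) x‖)) * ‖F (ν, (T ν).symm x)‖ = 0 :=
      Finset.sum_eq_zero fun ν _ => by rw [hF (ν, (T ν).symm x) rfl, norm_zero, mul_zero]
    rw [h0, mul_zero] at h
    exact norm_le_zero_iff.mp h

end FirstOrder

/-! ## §2  (3.77) in block-`ℓ²` for letters typed between two carriers, through the block embedding -/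

section Hom

variable {g : B9.Geometry} [Fintype g.Site] {R : ℝ} {H : Prop} {X Y : Type} [Fintype X] [Fintype Y]

/-- **(3.77) IN BLOCK-`ℓ²` FOR LETTERS TYPED BETWEEN TWO CARRIERS** (`X` ∋ sites, `Y` ∋ bonds; blocks `blkX`, `blkY`): `B9Ineq377L2.ineq377_l2` with
`D, D′ = D + E : X → Y`, `D*, D*′ = D* + E* : Y → X`, `P = P(U)`, `P′ = P′(A)` letters of `X`, the (3.49)-entries `P`, `DP`, `PD*` (constant `κ_P`), the
(3.68)-entries `P′`, `DP′`, `P′D*`, `DP′D*` (constant `κ_{P′}α₁`) and the first-order letters `E`, `E*` (`c_Eα₁(Lʲη)⁻¹e^{−δd}`) as (two-carrier) block-`ℓ²`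
majorants (`B6RandomWalkL2Hom.HasL2MajorantHom`, [4] (2.140)) of the typed composites, all at one rate `δ`; Lemma 2.1 of [4] at exponent `α` (`ScaleTransfer`,
`Λ ≧ 1`), (2.61) at `β`, (2.54), `ρ + 2(α+β)δ₀ ≦ δ`.  CONCLUSION: on the `Y` carrier, `P₁ = (D′−D)PD* + DP(D*′−D*) + (D′−D)P(D*′−D*) + D′P′D*′ ≺₂
κ₃₇₇·α₁·(Lʲη)⁻²·e^{−ρd(y,y′)}`, `κ₃₇₇ = B9Ineq377POne.kappa377 c_E κ_P κ_{P′} Λ c₁(β) α₁` (the SAME constant as the sup shape).  Proof = the sup twin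
`B9Ineq377POneConcrete.ineq377_hom` word for word: embed all letters into `X ⊕ Y` by `emb₄` (`B6RandomWalkL2Blocks`), apply `ineq377_l2` there, read off the
bond block (`pOne_emb₄`, `hasL2Majorant_of_emb₄_inr_inr`).
[cite: Balaban1985BackgroundPropagators, (3.76)–(3.77) pp.405–406 + (3.49) p.399 + (3.68) p.403; Balaban1984PropagatorsII, Lemma 2.1 p.234 + (2.52)–(2.55) p.232 + (2.140) p.247] -/
theorem ineq377_l2_hom (blkX : X → g.Site) (blkY : Y → g.Site) (d : ℕ) (δ₀ δ α β ρ Λ cE κP κP' α₁ : ℝ)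
    (hcE : 0 ≤ cE) (hκP : 0 ≤ κP) (hκP' : 0 ≤ κP') (hα₁ : 0 ≤ α₁) (hΛ : 1 ≤ Λ) (hρ : 0 ≤ ρ) (hα : 0 ≤ α)
    (hβ : 0 ≤ β) (hδ₀ : 0 ≤ δ₀) (hr : ρ + 2 * ((α + β) * δ₀) ≤ δ)
    (hdnn : ∀ a b : g.Site, 0 ≤ g.dist a b) (htri : Triangle254 (toB6 g R H)) (hlen : ∀ y : g.Site, 0 < g.len y)
    (h261 : Ineq261 d (toB6 g R H) δ₀ β) (hT1i : ScaleTransfer g δ₀ α Λ (fun a => (g.len a)⁻¹))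
    {Dc Dc' Ec : (X → ℝ) →ₗ[ℝ] (Y → ℝ)} {Dsc Dsc' Esc : (Y → ℝ) →ₗ[ℝ] (X → ℝ)} {P Pp : Module.End ℝ (X → ℝ)}
    (hD' : Dc' = Dc + Ec) (hDs' : Dsc' = Dsc + Esc)
    (hP : HasL2Majorant (g := toB6 g R H) blkX P (fun a b => κP * Real.exp (-(δ * g.dist a b))))
    (hDP : HasL2MajorantHom (g := toB6 g R H) blkX blkY (Dc ∘ₗ P)
      (fun a b => κP * (g.len a)⁻¹ * Real.exp (-(δ * g.dist a b))))
    (hPDs : HasL2MajorantHom (g := toB6 g R H) blkY blkX (P ∘ₗ Dsc)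
      (fun a b => κP * (g.len a)⁻¹ * Real.exp (-(δ * g.dist a b))))
    (hPp : HasL2Majorant (g := toB6 g R H) blkX Pp (fun a b => κP' * α₁ * Real.exp (-(δ * g.dist a b))))
    (hDPp : HasL2MajorantHom (g := toB6 g R H) blkX blkY (Dc ∘ₗ Pp)
      (fun a b => κP' * α₁ * (g.len a)⁻¹ * Real.exp (-(δ * g.dist a b))))
    (hPpDs : HasL2MajorantHom (g := toB6 g R H) blkY blkX (Pp ∘ₗ Dsc)
      (fun a b => κP' * α₁ * (g.len a)⁻¹ * Real.exp (-(δ * g.dist a b))))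
    (hDPpDs : HasL2Majorant (g := toB6 g R H) blkY (Dc ∘ₗ Pp ∘ₗ Dsc)
      (fun a b => κP' * α₁ * (g.len a ^ 2)⁻¹ * Real.exp (-(δ * g.dist a b))))
    (hE : HasL2MajorantHom (g := toB6 g R H) blkX blkY Ec (fun a b => cE * α₁ * (g.len a)⁻¹ * Real.exp (-(δ * g.dist a b))))
    (hEs : HasL2MajorantHom (g := toB6 g R H) blkY blkX Esc (fun a b => cE * α₁ * (g.len a)⁻¹ * Real.exp (-(δ * g.dist a b)))) :
    HasL2Majorant (g := toB6 g R H) blkY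
      ((Dc' - Dc) ∘ₗ P ∘ₗ Dsc + Dc ∘ₗ P ∘ₗ (Dsc' - Dsc) + (Dc' - Dc) ∘ₗ P ∘ₗ (Dsc' - Dsc) + Dc' ∘ₗ Pp ∘ₗ Dsc')
      (fun a b => kappa377 cE κP κP' Λ (B6.c1 d δ₀ β) α₁ * α₁ * (g.len a ^ 2)⁻¹ * Real.exp (-(ρ * g.dist a b))) := by
  have hw1 : ∀ a : g.Site, 0 ≤ (g.len a)⁻¹ := fun a => inv_nonneg.mpr (hlen a).le
  have hw2 : ∀ a : g.Site, 0 ≤ (g.len a ^ 2)⁻¹ := fun a => inv_nonneg.mpr (sq_nonneg _)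
  have hK0 : ∀ a b : g.Site, 0 ≤ κP * Real.exp (-(δ * g.dist a b)) := fun a b => by positivity
  have hK1 : ∀ a b : g.Site, 0 ≤ κP * (g.len a)⁻¹ * Real.exp (-(δ * g.dist a b)) := fun a b => by
    have := hw1 a; positivity
  have hK2 : ∀ a b : g.Site, 0 ≤ κP' * α₁ * Real.exp (-(δ * g.dist a b)) := fun a b => by positivity
  have hK3 : ∀ a b : g.Site, 0 ≤ κP' * α₁ * (g.len a)⁻¹ * Real.exp (-(δ * g.dist a b)) := fun a b => by
    have := hw1 a; positivity
  have hK4 : ∀ a b : g.Site, 0 ≤ κP' * α₁ * (g.len a ^ 2)⁻¹ * Real.exp (-(δ * g.dist a b)) := fun a b => by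
    have := hw2 a; positivity
  have hK5 : ∀ a b : g.Site, 0 ≤ cE * α₁ * (g.len a)⁻¹ * Real.exp (-(δ * g.dist a b)) := fun a b => by
    have := hw1 a; positivity
  -- the letters on the sum carrier `X ⊕ Y` and their majorants
  have hPW := hasL2Majorant_emb₄_inl_inl (g := toB6 g R H) (blkY := blkY) hP hK0
  have hDPW : HasL2Majorant (g := toB6 g R H) (Sum.elim blkX blkY)
      (emb₄ 0 0 Dc 0 * emb₄ P (0 : (Y → ℝ) →ₗ[ℝ] (X → ℝ)) (0 : (X → ℝ) →ₗ[ℝ] (Y → ℝ)) 0)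
      (fun a b => κP * (g.len a)⁻¹ * Real.exp (-(δ * g.dist a b))) := by
    rw [emb₄_C_mul_A]; exact hasL2Majorant_emb₄_inr_inl hDP hK1
  have hPDsW : HasL2Majorant (g := toB6 g R H) (Sum.elim blkX blkY)
      (emb₄ P (0 : (Y → ℝ) →ₗ[ℝ] (X → ℝ)) (0 : (X → ℝ) →ₗ[ℝ] (Y → ℝ)) 0 * emb₄ 0 Dsc 0 0)
      (fun a b => κP * (g.len a)⁻¹ * Real.exp (-(δ * g.dist a b))) := by
    rw [emb₄_A_mul_B]; exact hasL2Majorant_emb₄_inl_inr hPDs hK1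
  have hPpW := hasL2Majorant_emb₄_inl_inl (g := toB6 g R H) (blkY := blkY) hPp hK2
  have hDPpW : HasL2Majorant (g := toB6 g R H) (Sum.elim blkX blkY)
      (emb₄ 0 0 Dc 0 * emb₄ Pp (0 : (Y → ℝ) →ₗ[ℝ] (X → ℝ)) (0 : (X → ℝ) →ₗ[ℝ] (Y → ℝ)) 0)
      (fun a b => κP' * α₁ * (g.len a)⁻¹ * Real.exp (-(δ * g.dist a b))) := by
    rw [emb₄_C_mul_A]; exact hasL2Majorant_emb₄_inr_inl hDPp hK3
  have hPpDsW : HasL2Majorant (g := toB6 g R H) (Sum.elim blkX blkY)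
      (emb₄ Pp (0 : (Y → ℝ) →ₗ[ℝ] (X → ℝ)) (0 : (X → ℝ) →ₗ[ℝ] (Y → ℝ)) 0 * emb₄ 0 Dsc 0 0)
      (fun a b => κP' * α₁ * (g.len a)⁻¹ * Real.exp (-(δ * g.dist a b))) := by
    rw [emb₄_A_mul_B]; exact hasL2Majorant_emb₄_inl_inr hPpDs hK3
  have hDPpDsW : HasL2Majorant (g := toB6 g R H) (Sum.elim blkX blkY)
      (emb₄ 0 0 Dc 0 * emb₄ Pp (0 : (Y → ℝ) →ₗ[ℝ] (X → ℝ)) (0 : (X → ℝ) →ₗ[ℝ] (Y → ℝ)) 0 * emb₄ 0 Dsc 0 0)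
      (fun a b => κP' * α₁ * (g.len a ^ 2)⁻¹ * Real.exp (-(δ * g.dist a b))) := by
    rw [emb₄_C_mul_A_mul_B]; exact hasL2Majorant_emb₄_inr_inr hDPpDs hK4
  have hEW := hasL2Majorant_emb₄_inr_inl (g := toB6 g R H) hE hK5
  have hEsW := hasL2Majorant_emb₄_inl_inr (g := toB6 g R H) hEs hK5
  have hD'W : emb₄ (0 : Module.End ℝ (X → ℝ)) (0 : (Y → ℝ) →ₗ[ℝ] (X → ℝ)) Dc' (0 : Module.End ℝ (Y → ℝ))
      = emb₄ 0 0 Dc 0 + emb₄ 0 0 Ec 0 := by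
    rw [emb₄_add, hD']; simp
  have hDs'W : emb₄ (0 : Module.End ℝ (X → ℝ)) Dsc' (0 : (X → ℝ) →ₗ[ℝ] (Y → ℝ)) (0 : Module.End ℝ (Y → ℝ))
      = emb₄ 0 Dsc 0 0 + emb₄ 0 Esc 0 0 := by
    rw [emb₄_add, hDs']; simp
  have h := ineq377_l2 (R := R) (H := H) (Sum.elim blkX blkY) d δ₀ δ α β ρ Λ cE κP κP' α₁ hcE hκP hκP' hα₁ hΛ hρ hα hβ hδ₀ hr
    hdnn htri hlen h261 hT1i hD'W hDs'W hPW hDPW hPDsW hPpW hDPpW hPpDsW hDPpDsW hEW hEsW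
  rw [pOne_emb₄] at h
  exact hasL2Majorant_of_emb₄_inr_inr h

end Hom

/-! ## §3  (3.77) in block-`ℓ²` with the differential letters concrete -/

section Concrete

variable {𝔸 : Type*} [NormedRing 𝔸] [NormedAlgebra ℂ 𝔸] [CompleteSpace 𝔸] {ι : Type} [Fintype ι] [DecidableEq ι]
variable (b : Module.Basis ι ℝ 𝔸) {S : Type} [Fintype S] [DecidableEq S] {κ : Type} [Fintype κ] [DecidableEq κ]
variable (T : κ → Equiv.Perm S) (U : κ → S → 𝔸ˣ)
variable {g : B9.Geometry} [Fintype g.Site] {Rr : ℝ} {H : Prop}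

/-- **(3.77) IN BLOCK-`ℓ²` FOR THE CONCRETE DIFFERENTIAL LETTERS OF (3.76)**: the sup twin `B9Ineq377POneConcrete.ineq377_concreteE` word for word in the
block-`ℓ²` shape — with `D := conjHom b (η⁻¹D¹_U)`, `D′ := conjHom b (η⁻¹D¹_{U′U})` (sites → bonds), `D* := conjHom b (η⁻¹Σ_νD¹*_{U,ν})`, `D*′` (bonds → sites)
and ANY site-carrier letters `P = P(U)`, `P′ = P′(A)` with the typed (3.49)/(3.68) entries as block-`ℓ²` (two-carrier) majorants at a rate `δ`: under (3.37)
blockwise, `η·α₁(Lʲη)⁻¹ ≦ 1/4`, a group-valued background, `|b.repr w i| ≦ M₂‖w‖`, the neighbour geometry `d(y(x), y(x ± e_μ)) ≦ d₀` and the located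
devices' geometry ((2.54), (2.61) at `β`, Lemma 2.1 at `α` with `Λ ≧ 1`, `ρ + 2(α+β)δ₀ ≦ δ`):
`P₁(A) ≺₂ κ₃₇₇(c_E, κ_P, κ_{P′}, Λ, c₁(β), α₁)·α₁·(Lʲη)⁻²·e^{−ρd(y,y′)}` on the bond carrier, `c_E = √((#κ+1)·#ι)·4(1 + #κ)·M₂Σ_i‖b_i‖·e^{δd₀}` (§1's
block-`ℓ²` sizes of `D_{U′U} − D_U`, `D*_{U′U} − D*_U`: the sup sizes of FILE 10 times the multiplicity factor of the one-point stencils).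
[cite: Balaban1985BackgroundPropagators, (3.76)–(3.77) pp.405–406 + (3.70)/(3.74) pp.404–405 + (3.37) p.396 + (3.49) p.399 + (3.68) p.403; Balaban1984PropagatorsII, Lemma 2.1 p.234 + (2.51)–(2.55) p.232 + (2.140) p.247] -/
theorem ineq377_l2_concreteE (blk : S → g.Site) (d : ℕ) (δ₀ δ α β ρ Λ κP κP' α₁ d₀ M₂ : ℝ)
    (hκP : 0 ≤ κP) (hκP' : 0 ≤ κP') (hα₁ : 0 ≤ α₁) (hΛ : 1 ≤ Λ) (hρ : 0 ≤ ρ) (hα : 0 ≤ α) (hβ : 0 ≤ β) (hδ₀ : 0 ≤ δ₀)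
    (hδ : 0 ≤ δ) (hM₂ : 0 ≤ M₂) (hr : ρ + 2 * ((α + β) * δ₀) ≤ δ)
    (hdnn : ∀ a a' : g.Site, 0 ≤ g.dist a a') (htri : Triangle254 (toB6 g Rr H)) (hlen : ∀ y : g.Site, 0 < g.len y)
    (h261 : Ineq261 d (toB6 g Rr H) δ₀ β) (hT1i : ScaleTransfer g δ₀ α Λ (fun a => (g.len a)⁻¹))
    (hrepr : ∀ (w : 𝔸) (i : ι), |b.repr w i| ≤ M₂ * ‖w‖) {η : ℝ} (hη : 0 < η)
    (hU1 : ∀ m z, ‖((U m z : 𝔸ˣ) : 𝔸)‖ ≤ 1 ∧ ‖(((U m z)⁻¹ : 𝔸ˣ) : 𝔸)‖ ≤ 1) (A : κ → S → 𝔸)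
    (hA : ∀ k x, ‖A k x‖ ≤ α₁ * (g.len (blk x))⁻¹) (hAτB : ∀ ν x, ‖tauB T U ν (A ν) x‖ ≤ α₁ * (g.len (blk x))⁻¹)
    (hsmall : ∀ y : g.Site, η * (α₁ * (g.len y)⁻¹) ≤ 1 / 4)
    (hd₀F : ∀ μ x, g.dist (blk x) (blk (T μ x)) ≤ d₀) (hd₀B : ∀ ν x, g.dist (blk x) (blk ((T ν).symm x)) ≤ d₀)
    {P Pp : Module.End ℝ (S × ι → ℝ)}
    (hP : HasL2Majorant (g := toB6 g Rr H) (fun p : S × ι => blk p.1) P (fun a a' => κP * Real.exp (-(δ * g.dist a a'))))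
    (hDP : HasL2MajorantHom (g := toB6 g Rr H) (fun p : S × ι => blk p.1) (fun q : (κ × S) × ι => blk q.1.2)
      (conjHom b (gradLin T ((η : ℂ)⁻¹) U) ∘ₗ P) (fun a a' => κP * (g.len a)⁻¹ * Real.exp (-(δ * g.dist a a'))))
    (hPDs : HasL2MajorantHom (g := toB6 g Rr H) (fun q : (κ × S) × ι => blk q.1.2) (fun p : S × ι => blk p.1)
      (P ∘ₗ conjHom b (divLin T ((η : ℂ)⁻¹) U)) (fun a a' => κP * (g.len a)⁻¹ * Real.exp (-(δ * g.dist a a'))))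
    (hPp : HasL2Majorant (g := toB6 g Rr H) (fun p : S × ι => blk p.1) Pp (fun a a' => κP' * α₁ * Real.exp (-(δ * g.dist a a'))))
    (hDPp : HasL2MajorantHom (g := toB6 g Rr H) (fun p : S × ι => blk p.1) (fun q : (κ × S) × ι => blk q.1.2)
      (conjHom b (gradLin T ((η : ℂ)⁻¹) U) ∘ₗ Pp) (fun a a' => κP' * α₁ * (g.len a)⁻¹ * Real.exp (-(δ * g.dist a a'))))
    (hPpDs : HasL2MajorantHom (g := toB6 g Rr H) (fun q : (κ × S) × ι => blk q.1.2) (fun p : S × ι => blk p.1)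
      (Pp ∘ₗ conjHom b (divLin T ((η : ℂ)⁻¹) U)) (fun a a' => κP' * α₁ * (g.len a)⁻¹ * Real.exp (-(δ * g.dist a a'))))
    (hDPpDs : HasL2Majorant (g := toB6 g Rr H) (fun q : (κ × S) × ι => blk q.1.2)
      (conjHom b (gradLin T ((η : ℂ)⁻¹) U) ∘ₗ Pp ∘ₗ conjHom b (divLin T ((η : ℂ)⁻¹) U))
      (fun a a' => κP' * α₁ * (g.len a ^ 2)⁻¹ * Real.exp (-(δ * g.dist a a')))) :
    HasL2Majorant (g := toB6 g Rr H) (fun q : (κ × S) × ι => blk q.1.2)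
      ((conjHom b (gradLin T ((η : ℂ)⁻¹) (prodCfg U η A)) - conjHom b (gradLin T ((η : ℂ)⁻¹) U)) ∘ₗ P
            ∘ₗ conjHom b (divLin T ((η : ℂ)⁻¹) U)
        + conjHom b (gradLin T ((η : ℂ)⁻¹) U) ∘ₗ P
            ∘ₗ (conjHom b (divLin T ((η : ℂ)⁻¹) (prodCfg U η A)) - conjHom b (divLin T ((η : ℂ)⁻¹) U))
        + (conjHom b (gradLin T ((η : ℂ)⁻¹) (prodCfg U η A)) - conjHom b (gradLin T ((η : ℂ)⁻¹) U)) ∘ₗ P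
            ∘ₗ (conjHom b (divLin T ((η : ℂ)⁻¹) (prodCfg U η A)) - conjHom b (divLin T ((η : ℂ)⁻¹) U))
        + conjHom b (gradLin T ((η : ℂ)⁻¹) (prodCfg U η A)) ∘ₗ Pp ∘ₗ conjHom b (divLin T ((η : ℂ)⁻¹) (prodCfg U η A)))
      (fun a a' => kappa377 (Real.sqrt (((Fintype.card κ + 1) * Fintype.card ι : ℕ) : ℝ)
          * (4 * (1 + Fintype.card κ) * (M₂ * ∑ i, ‖b i‖) * Real.exp (δ * d₀))) κP κP' Λ (B6.c1 d δ₀ β) α₁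
        * α₁ * (g.len a ^ 2)⁻¹ * Real.exp (-(ρ * g.dist a a'))) := by
  set M : ℝ := M₂ * ∑ i, ‖b i‖ with hM
  set r : ℝ := Real.sqrt (((Fintype.card κ + 1) * Fintype.card ι : ℕ) : ℝ) with hr_def
  have hr0 : 0 ≤ r := Real.sqrt_nonneg _
  have hbsum : 0 ≤ ∑ i, ‖b i‖ := Finset.sum_nonneg fun i _ => norm_nonneg _
  have hM0 : 0 ≤ M := mul_nonneg hM₂ hbsum
  have hcard : (0 : ℝ) ≤ Fintype.card κ := Nat.cast_nonneg _
  have hcE : 0 ≤ r * (4 * (1 + Fintype.card κ) * M * Real.exp (δ * d₀)) := by positivity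
  have hw1 : ∀ a : g.Site, 0 ≤ (g.len a)⁻¹ := fun a => inv_nonneg.mpr (hlen a).le
  -- §1's block-ℓ² sizes of the first-order letters, weakened to the common constant `c_E`
  have hE₀ := hasL2MajorantHom_gradLin_sub (Rr := Rr) (H := H) T U b blk hη hU1 A d₀ δ M₂ α₁ hα₁ hδ hM₂ hrepr hlen hA hsmall hd₀F
  have hEs₀ := hasL2MajorantHom_divLin_sub (Rr := Rr) (H := H) T U b blk hη hU1 A d₀ δ M₂ α₁ hα₁ hδ hM₂ hrepr hlen hAτB hsmall hd₀B
  have hE : HasL2MajorantHom (g := toB6 g Rr H) (fun p : S × ι => blk p.1) (fun q : (κ × S) × ι => blk q.1.2)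
      (conjHom b (gradLin T ((η : ℂ)⁻¹) (prodCfg U η A)) - conjHom b (gradLin T ((η : ℂ)⁻¹) U))
      (fun a a' => r * (4 * (1 + Fintype.card κ) * M * Real.exp (δ * d₀)) * α₁ * (g.len a)⁻¹ * Real.exp (-(δ * g.dist a a'))) := by
    rw [← conjHom_sub]
    refine B6RandomWalkL2Hom.hasL2MajorantHom_mono _ _ hE₀ fun a a' => ?_
    have h0 : 0 ≤ M * Real.exp (δ * d₀) * α₁ * (g.len a)⁻¹ * Real.exp (-(δ * g.dist a a')) := by
      have := hw1 a; positivity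
    have base : 4 * M * Real.exp (δ * d₀) * α₁ * (g.len a)⁻¹ * Real.exp (-(δ * g.dist a a'))
        ≤ 4 * (1 + Fintype.card κ) * M * Real.exp (δ * d₀) * α₁ * (g.len a)⁻¹ * Real.exp (-(δ * g.dist a a')) := by
      nlinarith
    have h1 := mul_le_mul_of_nonneg_left base hr0
    calc r * (4 * M * Real.exp (δ * d₀) * α₁ * (g.len a)⁻¹ * Real.exp (-(δ * g.dist a a')))
        ≤ r * (4 * (1 + Fintype.card κ) * M * Real.exp (δ * d₀) * α₁ * (g.len a)⁻¹ * Real.exp (-(δ * g.dist a a'))) := h1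
      _ = r * (4 * (1 + Fintype.card κ) * M * Real.exp (δ * d₀)) * α₁ * (g.len a)⁻¹ * Real.exp (-(δ * g.dist a a')) := by ring
  have hEs : HasL2MajorantHom (g := toB6 g Rr H) (fun q : (κ × S) × ι => blk q.1.2) (fun p : S × ι => blk p.1)
      (conjHom b (divLin T ((η : ℂ)⁻¹) (prodCfg U η A)) - conjHom b (divLin T ((η : ℂ)⁻¹) U))
      (fun a a' => r * (4 * (1 + Fintype.card κ) * M * Real.exp (δ * d₀)) * α₁ * (g.len a)⁻¹ * Real.exp (-(δ * g.dist a a'))) := by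
    rw [← conjHom_sub]
    refine B6RandomWalkL2Hom.hasL2MajorantHom_mono _ _ hEs₀ fun a a' => ?_
    have h0 : 0 ≤ M * Real.exp (δ * d₀) * α₁ * (g.len a)⁻¹ * Real.exp (-(δ * g.dist a a')) := by
      have := hw1 a; positivity
    have base : 4 * Fintype.card κ * M * Real.exp (δ * d₀) * α₁ * (g.len a)⁻¹ * Real.exp (-(δ * g.dist a a'))
        ≤ 4 * (1 + Fintype.card κ) * M * Real.exp (δ * d₀) * α₁ * (g.len a)⁻¹ * Real.exp (-(δ * g.dist a a')) := by
      nlinarith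
    have h1 := mul_le_mul_of_nonneg_left base hr0
    calc r * (4 * Fintype.card κ * M * Real.exp (δ * d₀) * α₁ * (g.len a)⁻¹ * Real.exp (-(δ * g.dist a a')))
        ≤ r * (4 * (1 + Fintype.card κ) * M * Real.exp (δ * d₀) * α₁ * (g.len a)⁻¹ * Real.exp (-(δ * g.dist a a'))) := h1
      _ = r * (4 * (1 + Fintype.card κ) * M * Real.exp (δ * d₀)) * α₁ * (g.len a)⁻¹ * Real.exp (-(δ * g.dist a a')) := by ring
  exact ineq377_l2_hom (R := Rr) (H := H) (fun p : S × ι => blk p.1) (fun q : (κ × S) × ι => blk q.1.2) d δ₀ δ α β ρ Λ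
    (r * (4 * (1 + Fintype.card κ) * M * Real.exp (δ * d₀))) κP κP' α₁ hcE hκP hκP' hα₁ hΛ hρ hα hβ hδ₀ hr hdnn htri hlen h261 hT1i
    (add_sub_cancel _ _).symm (add_sub_cancel _ _).symm hP hDP hPDs hPp hDPp hPpDs hDPpDs hE hEs

end Concrete

end Literature.MathematicalPhysics.QuantumFieldTheory.Balaban1983to89.B9Ineq377L2Hom
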